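import Literature.Analysis.FluidPDE.LerayHopfTimeSliceTorus
import Literature.Analysis.FluidPDE.DissipationAnomalyProofs
import Literature.Analysis.FluidPDE.LerayHopfProofs
import Literature.Analysis.FluidPDE.ZerothLaw
import HarnessLib

/-!
# Leray–Hopf solutions on the torus: measurability in time of the spectral norms, and slices

Analysis/FluidPDE support file. For a Leray–Hopf solution `u` on `T^d × [0, T)`
(`Torus.IsLerayHopfOn`, accepted `Literature.Analysis.FluidPDE.LerayHopf`) the long-time
averages of the turbulence statements (`Turb.meanDissipation`, `Turb.meanEnergy`,
`Turb.meanEnstrophyDissipation` of `ZerothLaw`) integrate in time the slice functionals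
`t ↦ ‖∇u(t)‖₂²` (`Torus.eGradNormSq`), `t ↦ ‖u(t)‖₂²` and `t ↦ ‖Δu(t)‖₂²`
(`Turb.eLaplacianNormSq`). This file proves that these integrands are honest measurable /
integrable functions of time, from the joint measurability clause of the weak formulation alone
(Fubini: the Fourier coefficient `t ↦ 𝓕(uᵢ(t))(k)` is a fibre integral,
`Literature.Analysis.FluidPDE.Torus.aestronglyMeasurable_mFourierCoeff_slice`, and the spectral norms are
countable sums of their squared moduli):

* `IsLerayHopfOn.aemeasurable_enorm_sq_mFourierCoeff`, `…aemeasurable_eGradNormSq`,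
  `…aemeasurable_eLaplacianNormSq`, `…aestronglyMeasurable_toReal_eGradNormSq` (on `(0,T)`),
  and the global versions on `(0, ∞)` for `Torus.IsGlobalLerayHopf`;
* `IsLerayHopfOn.integrableOn_integral_norm_sq` — `t ↦ ‖u(t)‖₂²` is integrable on `(0, T]`
  (bounded a.e. by the energy bound, measurable by Fubini);
* `integrableOn_toReal_eLaplacianNormSq_of_memL2Sobolev`,
  `ae_eLaplacianNormSq_lt_top_of_memL2Sobolev` — `u ∈ L²(0,T;H²)` (`Torus.MemL2Sobolev 0 T 2`)
  makes `t ↦ ‖Δu(t)‖₂²` integrable on `(0,T]` and a.e. finite (`|·|_{Ḣ²} ≤ ‖·‖_{H²}`,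
  `Torus.eHomSobolevSeminorm_le_eSobolevNorm`);
* `IsLerayHopfOn.isWeaklyDivFree_datum` — the torus twin of the whole-space
  `Literature.Analysis.FluidPDE.IsLerayHopfOn.isWeaklyDivFree_datum`: the datum of a Leray–Hopf solution is weakly
  divergence free (weak `L²` continuity at `0⁺` against `∇θ`).

These are the regularity inputs of `Literature.Analysis.FluidPDE.meanDissipation_sq_le_of_regular`
(`AlexakisDoeringInterpolation`) that hold for *every* Leray–Hopf solution; the remaining ones
(`H²` in time) come from the 2-D theory (`Literature.Analysis.FluidPDE.fmrt_enstrophy_balance_torus2`).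

## Mathlib search

Used: `MeasureTheory.AEStronglyMeasurable.integral_prod_right'` (through the tree's slice
lemma), `AEMeasurable.tsum`, `ae_lt_top'`, `integrable_toReal_of_lintegral_ne_top`,
`ae_restrict_iUnion_iff`, `aemeasurable_iUnion_iff`.

## References

* R. Temam, *Navier–Stokes Equations*, North-Holland 1984, Ch. III §1.1 (the spaces
  `L²(0,T;V)`, measurability in time of `t ↦ ‖u(t)‖`).
-/

noncomputable section

open MeasureTheory TopologicalSpace Set Function Filter Topology UnitAddTorus
open scoped RealInnerProductSpace ENNReal NNReal

namespace Literature.Analysis.FluidPDE.Torus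

variable {d : Type*} [Fintype d]

/-! ### Spectral norms as sums of squared moduli of slice Fourier coefficients -/

section Spectral

/-- The squared homogeneous `Ḣ²` seminorm as a series:
`|f|²_{Ḣ²} = ∑ₖ |k|⁴ ‖f̂ₖ‖²` off `k = 0` (unfolding). [folklore] -/
theorem eHomSobolevSeminorm_two_sq_eq_tsum' {F : Type*} [NormedAddCommGroup F] [NormedSpace ℂ F]
    (f : UnitAddTorus d → F) :
    FunctionSpaces.Torus.eHomSobolevSeminorm 2 f ^ 2 =
      ∑' k : d → ℤ, (if k = 0 then 0 else ENNReal.ofReal (FunctionSpaces.Torus.freqNormSq k ^ (2 : ℝ))) *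
        ‖mFourierCoeff f k‖ₑ ^ 2 := by
  rw [FunctionSpaces.Torus.eHomSobolevSeminorm, ENNReal.rpow_half_sq]

/-- For an integrable real field, the squared modulus of a Fourier coefficient of the
complexification is the sum over components: `‖𝓕(complexify ∘ v)(k)‖² = ∑ᵢ ‖𝓕(vᵢ)(k)‖²`
(`Torus.mFourierCoeff_complexify_apply`). [folklore] -/
theorem enorm_sq_mFourierCoeff_complexify_eq_sum {v : UnitAddTorus d → EuclideanSpace ℝ d}
    (hv : Integrable v volume) (k : d → ℤ) :
    ‖mFourierCoeff (FunctionSpaces.EuclideanSpace.complexify ∘ v) k‖ₑ ^ 2 =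
      ∑ i, ‖mFourierCoeff (fun x => (v x i : ℂ)) k‖ₑ ^ 2 := by
  rw [FunctionSpaces.Torus.enorm_sq_eq_sum_euclidean]
  refine Finset.sum_congr rfl fun i _ => ?_
  rw [FunctionSpaces.Torus.mFourierCoeff_complexify_apply hv k i]

end Spectral

/-! ### Measurability in time along a Leray–Hopf solution -/

section Measurability

variable [DecidableEq d] {T ν : ℝ} {f u : ℝ → UnitAddTorus d → EuclideanSpace ℝ d}
  {u₀ : UnitAddTorus d → EuclideanSpace ℝ d}

/-- Along a Leray–Hopf solution, `t ↦ ‖𝓕(complexify ∘ u(t))(k)‖²` is a.e.-measurable on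
`(0, T)` (componentwise Fubini measurability of the slice Fourier coefficients,
`aestronglyMeasurable_mFourierCoeff_slice`; every slice is integrable). [folklore] -/
theorem IsLerayHopfOn.aemeasurable_enorm_sq_mFourierCoeff (hu : IsLerayHopfOn T ν f u₀ u)
    (k : d → ℤ) :
    AEMeasurable (fun t => ‖mFourierCoeff (FunctionSpaces.EuclideanSpace.complexify ∘ u t) k‖ₑ ^ 2)
      (volume.restrict (Ioo 0 T)) := by
  have hcomp : ∀ i : d, AEMeasurable (fun t => ‖mFourierCoeff (fun x => (u t x i : ℂ)) k‖ₑ ^ 2)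
      (volume.restrict (Ioo 0 T)) := fun i =>
    (aestronglyMeasurable_mFourierCoeff_slice hu.aestronglyMeasurable_uncurry i k).enorm.pow_const 2
  refine (Finset.aemeasurable_sum Finset.univ fun i _ => hcomp i).congr ?_
  filter_upwards [ae_restrict_mem measurableSet_Ioo] with t ht
  rw [Finset.sum_apply]
  exact (enorm_sq_mFourierCoeff_complexify_eq_sum
    ((hu.memLp t (Ioo_subset_Icc_self ht)).integrable one_le_two) k).symm

/-- Along a Leray–Hopf solution, the spectral dissipation `t ↦ ‖∇u(t)‖₂²` (`Torus.eGradNormSq`,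
values in `[0, ∞]`) is a.e.-measurable on `(0, T)` (countable sum of measurable terms). [folklore] -/
theorem IsLerayHopfOn.aemeasurable_eGradNormSq (hu : IsLerayHopfOn T ν f u₀ u) :
    AEMeasurable (fun t => FunctionSpaces.Torus.eGradNormSq (u t)) (volume.restrict (Ioo 0 T)) := by
  have h : (fun t => FunctionSpaces.Torus.eGradNormSq (u t)) = fun t =>
      ENNReal.ofReal (4 * Real.pi ^ 2) * ∑' k : d → ℤ, ENNReal.ofReal (FunctionSpaces.Torus.freqNormSq k) *
        ‖mFourierCoeff (FunctionSpaces.EuclideanSpace.complexify ∘ u t) k‖ₑ ^ 2 := by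
    funext t; exact FunctionSpaces.Torus.eGradNormSq_eq_tsum (u t)
  rw [h]
  exact (AEMeasurable.tsum fun k =>
    (hu.aemeasurable_enorm_sq_mFourierCoeff k).const_mul _).const_mul _

/-- Along a Leray–Hopf solution, the spectral enstrophy dissipation `t ↦ ‖Δu(t)‖₂²`
(`Turb.eLaplacianNormSq`, values in `[0, ∞]`) is a.e.-measurable on `(0, T)`. [folklore] -/
theorem IsLerayHopfOn.aemeasurable_eLaplacianNormSq (hu : IsLerayHopfOn T ν f u₀ u) :
    AEMeasurable (fun t => eLaplacianNormSq (u t)) (volume.restrict (Ioo 0 T)) := by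
  have h : (fun t => eLaplacianNormSq (u t)) = fun t =>
      ENNReal.ofReal (16 * Real.pi ^ 4) * ∑' k : d → ℤ,
        (if k = 0 then 0 else ENNReal.ofReal (FunctionSpaces.Torus.freqNormSq k ^ (2 : ℝ))) *
          ‖mFourierCoeff (FunctionSpaces.EuclideanSpace.complexify ∘ u t) k‖ₑ ^ 2 := by
    funext t
    rw [eLaplacianNormSq, eHomSobolevSeminorm_two_sq_eq_tsum']
  rw [h]
  exact (AEMeasurable.tsum fun k =>
    (hu.aemeasurable_enorm_sq_mFourierCoeff k).const_mul _).const_mul _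

/-- Real form: `t ↦ (‖∇u(t)‖₂²).toReal` is a.e.-strongly measurable on `(0, T)`. [folklore] -/
theorem IsLerayHopfOn.aestronglyMeasurable_toReal_eGradNormSq (hu : IsLerayHopfOn T ν f u₀ u) :
    AEStronglyMeasurable (fun t => (FunctionSpaces.Torus.eGradNormSq (u t)).toReal)
      (volume.restrict (Ioo 0 T)) :=
  hu.aemeasurable_eGradNormSq.ennreal_toReal.aestronglyMeasurable

/-- Real form: `t ↦ (‖Δu(t)‖₂²).toReal` is a.e.-strongly measurable on `(0, T)`. [folklore] -/
theorem IsLerayHopfOn.aestronglyMeasurable_toReal_eLaplacianNormSq (hu : IsLerayHopfOn T ν f u₀ u) :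
    AEStronglyMeasurable (fun t => (eLaplacianNormSq (u t)).toReal) (volume.restrict (Ioo 0 T)) :=
  hu.aemeasurable_eLaplacianNormSq.ennreal_toReal.aestronglyMeasurable

/-- **The energy slice is integrable in time**: along a Leray–Hopf solution,
`t ↦ ‖u(t)‖₂² = ∫ ‖u(t,x)‖² dx` is integrable on `(0, T)` — measurable by Fubini and bounded
a.e. by the `L^∞(0,T;L²)` clause (`IsLerayHopfOn.exists_integral_norm_sq_le`). [folklore] -/
theorem IsLerayHopfOn.integrableOn_integral_norm_sq (hu : IsLerayHopfOn T ν f u₀ u) :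
    IntegrableOn (fun t => ∫ x, ‖u t x‖ ^ 2) (Ioo 0 T) := by
  have hmeas : AEStronglyMeasurable (fun t => ∫ x, ‖u t x‖ ^ 2) (volume.restrict (Ioo 0 T)) := by
    have h1 : AEStronglyMeasurable (fun p : ℝ × UnitAddTorus d => ‖uncurry u p‖ ^ 2)
        ((volume.restrict (Ioo 0 T)).prod volume) :=
      (hu.aestronglyMeasurable_uncurry.norm.pow 2)
    exact h1.integral_prod_right'
  obtain ⟨C, -, hC⟩ := hu.exists_integral_norm_sq_le
  haveI : IsFiniteMeasure (volume.restrict (Ioo (0 : ℝ) T)) :=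
    isFiniteMeasure_restrict.mpr measure_Ioo_lt_top.ne
  refine Integrable.mono' (integrable_const C) hmeas ?_
  filter_upwards [hC] with t ht
  rw [Real.norm_of_nonneg (integral_nonneg fun x => sq_nonneg _)]
  exact ht

end Measurability

/-! ### Global versions on `(0, ∞)` -/

section Global

variable [DecidableEq d] {ν : ℝ} {f u : ℝ → UnitAddTorus d → EuclideanSpace ℝ d}
  {u₀ : UnitAddTorus d → EuclideanSpace ℝ d}

omit [Fintype d] [DecidableEq d] in
/-- `(0, ∞) = ⋃ₙ (0, n)` over `ℕ`. [folklore] -/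
theorem Ioi_zero_eq_iUnion_Ioo_nat : Ioi (0 : ℝ) = ⋃ n : ℕ, Ioo (0 : ℝ) n := by
  ext t
  simp only [mem_Ioi, mem_iUnion, mem_Ioo]
  constructor
  · intro ht
    obtain ⟨n, hn⟩ := exists_nat_gt t
    exact ⟨n, ht, hn⟩
  · rintro ⟨n, ht, -⟩
    exact ht

/-- Along a global Leray–Hopf solution, `t ↦ (‖∇u(t)‖₂²).toReal` is a.e.-strongly measurable
on `(0, ∞)`. [folklore] -/
theorem IsGlobalLerayHopf.aestronglyMeasurable_toReal_eGradNormSq (hu : IsGlobalLerayHopf ν f u₀ u) :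
    AEStronglyMeasurable (fun t => (FunctionSpaces.Torus.eGradNormSq (u t)).toReal)
      (volume.restrict (Ioi 0)) := by
  rw [Ioi_zero_eq_iUnion_Ioo_nat, aestronglyMeasurable_iUnion_iff]
  intro n
  rcases Nat.eq_zero_or_pos n with hn | hn
  · subst hn; simp
  · exact (hu n (by exact_mod_cast hn)).aestronglyMeasurable_toReal_eGradNormSq

/-- Along a global Leray–Hopf solution, `t ↦ ‖Δu(t)‖₂²` is a.e.-measurable on `(0, ∞)`. [folklore] -/
theorem IsGlobalLerayHopf.aemeasurable_eLaplacianNormSq (hu : IsGlobalLerayHopf ν f u₀ u) :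
    AEMeasurable (fun t => eLaplacianNormSq (u t)) (volume.restrict (Ioi 0)) := by
  rw [Ioi_zero_eq_iUnion_Ioo_nat, aemeasurable_iUnion_iff]
  intro n
  rcases Nat.eq_zero_or_pos n with hn | hn
  · subst hn; simp
  · exact (hu n (by exact_mod_cast hn)).aemeasurable_eLaplacianNormSq

/-- Along a global Leray–Hopf solution every slice `u(t)`, `t ≥ 0`, is in `L²`. [folklore] -/
theorem IsGlobalLerayHopf.memLp_two (hu : IsGlobalLerayHopf ν f u₀ u) {t : ℝ} (ht : 0 ≤ t) :
    MemLp (u t) 2 volume :=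
  (hu (t + 1) (by linarith)).memLp t ⟨ht, by linarith⟩

/-- Along a global Leray–Hopf solution, `t ↦ ‖u(t)‖₂²` is integrable on every `(0, T]`. [folklore] -/
theorem IsGlobalLerayHopf.integrableOn_integral_norm_sq (hu : IsGlobalLerayHopf ν f u₀ u) {T : ℝ}
    (hT : 0 < T) : IntegrableOn (fun t => ∫ x, ‖u t x‖ ^ 2) (Ioc 0 T) :=
  (integrableOn_Ioc_iff_integrableOn_Ioo).mpr (hu T hT).integrableOn_integral_norm_sq

end Global

/-! ### `L²(0,T;H²)` makes the enstrophy dissipation integrable and a.e. finite -/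

section H2

variable [DecidableEq d] {T ν : ℝ} {f u : ℝ → UnitAddTorus d → EuclideanSpace ℝ d}
  {u₀ : UnitAddTorus d → EuclideanSpace ℝ d}

omit [DecidableEq d] in
/-- `‖Δv‖₂² ≤ 16π⁴ ‖v‖²_{H²}` (the homogeneous seminorm is dominated by the full norm,
`Torus.eHomSobolevSeminorm_le_eSobolevNorm`). [folklore] -/
theorem eLaplacianNormSq_le_eSobolevNorm_two_sq (v : UnitAddTorus d → EuclideanSpace ℝ d) :
    eLaplacianNormSq v ≤ ENNReal.ofReal (16 * Real.pi ^ 4) *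
      FunctionSpaces.Torus.eSobolevNorm 2 (FunctionSpaces.EuclideanSpace.complexify ∘ v) ^ 2 := by
  unfold eLaplacianNormSq
  gcongr
  exact eHomSobolevSeminorm_le_eSobolevNorm zero_le_two _

omit [DecidableEq d] in
/-- `u ∈ L²(0,T;H²)` gives `∫₀ᵀ ‖Δu‖₂² < ∞` (in `[0, ∞]`). [folklore] -/
theorem lintegral_eLaplacianNormSq_lt_top_of_memL2Sobolev
    (h : FunctionSpaces.Torus.MemL2Sobolev 0 T 2 (fun t => FunctionSpaces.EuclideanSpace.complexify ∘ u t)) :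
    ∫⁻ t in Ioo 0 T, eLaplacianNormSq (u t) < ∞ := by
  have hfin : ∫⁻ t in Ioo 0 T, FunctionSpaces.Torus.eSobolevNorm 2
      (FunctionSpaces.EuclideanSpace.complexify ∘ u t) ^ 2 < ∞ := by
    have h2 := h.2
    unfold FunctionSpaces.Torus.eL2SobolevNorm at h2
    by_contra htop
    rw [not_lt, top_le_iff] at htop
    rw [htop, ENNReal.top_rpow_of_pos (by norm_num)] at h2
    exact lt_irrefl _ h2
  calc ∫⁻ t in Ioo 0 T, eLaplacianNormSq (u t)
      ≤ ∫⁻ t in Ioo 0 T, ENNReal.ofReal (16 * Real.pi ^ 4) *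
          FunctionSpaces.Torus.eSobolevNorm 2 (FunctionSpaces.EuclideanSpace.complexify ∘ u t) ^ 2 :=
        lintegral_mono fun t => eLaplacianNormSq_le_eSobolevNorm_two_sq (u t)
    _ = ENNReal.ofReal (16 * Real.pi ^ 4) * ∫⁻ t in Ioo 0 T,
          FunctionSpaces.Torus.eSobolevNorm 2 (FunctionSpaces.EuclideanSpace.complexify ∘ u t) ^ 2 :=
        lintegral_const_mul' _ _ ENNReal.ofReal_ne_top
    _ < ∞ := ENNReal.mul_lt_top ENNReal.ofReal_lt_top hfin

/-- For a Leray–Hopf solution in `L²(0,T;H²)`, `t ↦ (‖Δu(t)‖₂²).toReal` is integrable on `(0, T]`. [folklore] -/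
theorem IsLerayHopfOn.integrableOn_toReal_eLaplacianNormSq (hu : IsLerayHopfOn T ν f u₀ u)
    (h : FunctionSpaces.Torus.MemL2Sobolev 0 T 2 (fun t => FunctionSpaces.EuclideanSpace.complexify ∘ u t)) :
    IntegrableOn (fun t => (eLaplacianNormSq (u t)).toReal) (Ioc 0 T) :=
  (integrableOn_Ioc_iff_integrableOn_Ioo).mpr
    (integrable_toReal_of_lintegral_ne_top hu.aemeasurable_eLaplacianNormSq
      (lintegral_eLaplacianNormSq_lt_top_of_memL2Sobolev h).ne)

/-- For a Leray–Hopf solution in `L²(0,T;H²)`, `‖Δu(t)‖₂² < ∞` for a.e. `t ∈ (0, T)`. [folklore] -/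
theorem IsLerayHopfOn.ae_eLaplacianNormSq_lt_top (hu : IsLerayHopfOn T ν f u₀ u)
    (h : FunctionSpaces.Torus.MemL2Sobolev 0 T 2 (fun t => FunctionSpaces.EuclideanSpace.complexify ∘ u t)) :
    ∀ᵐ t ∂(volume.restrict (Ioo 0 T)), eLaplacianNormSq (u t) < ∞ :=
  ae_lt_top' hu.aemeasurable_eLaplacianNormSq (lintegral_eLaplacianNormSq_lt_top_of_memL2Sobolev h).ne

/-- Global form: if a global Leray–Hopf solution is in `L²(0,T;H²)` for every `T > 0`, then
`‖Δu(t)‖₂² < ∞` for a.e. `t > 0`. [folklore] -/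
theorem IsGlobalLerayHopf.ae_eLaplacianNormSq_ne_top (hu : IsGlobalLerayHopf ν f u₀ u)
    (h : ∀ T, 0 < T →
      FunctionSpaces.Torus.MemL2Sobolev 0 T 2 (fun t => FunctionSpaces.EuclideanSpace.complexify ∘ u t)) :
    ∀ᵐ t ∂(volume.restrict (Ioi 0)), eLaplacianNormSq (u t) ≠ ∞ := by
  rw [Ioi_zero_eq_iUnion_Ioo_nat, ae_restrict_iUnion_iff]
  intro n
  rcases Nat.eq_zero_or_pos n with hn | hn
  · subst hn; simp
  · have hn' : (0 : ℝ) < n := by exact_mod_cast hn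
    filter_upwards [(hu n hn').ae_eLaplacianNormSq_lt_top (h n hn')] with t ht
    exact ht.ne

end H2

/-! ### The datum of a Leray–Hopf solution is weakly divergence free -/

section Datum

variable [DecidableEq d] {T ν : ℝ} {f u : ℝ → UnitAddTorus d → EuclideanSpace ℝ d}
  {u₀ : UnitAddTorus d → EuclideanSpace ℝ d}

/-- **The datum is weakly divergence free** (torus twin of
`Literature.Analysis.FluidPDE.IsLerayHopfOn.isWeaklyDivFree_datum`): for a smooth `θ`,
`∫ ⟪u₀, ∇θ⟫ = lim_{t→0⁺} ∫ ⟪u(t), ∇θ⟫` by weak `L²` continuity, and the pairings on the right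
vanish for a.e. `t ∈ (0, T)` (`u(t)` weakly divergence free). [folklore] -/
theorem IsLerayHopfOn.isWeaklyDivFree_datum (hu : IsLerayHopfOn T ν f u₀ u) (hT : 0 < T) :
    FunctionSpaces.Torus.IsWeaklyDivFree u₀ := by
  intro θ hθ
  have hw : MemLp (FunctionSpaces.Torus.gradient θ) 2 volume := hθ.gradient.memLp 2
  have hlim := (hu.weak_continuous _ hw).2
  have hae : ∀ᵐ t ∂(volume.restrict (Ioo 0 T)), (∫ x, ⟪u t x, FunctionSpaces.Torus.gradient θ x⟫) = 0 :=
    hu.weak.ae_isWeaklyDivFree.mono fun t ht => ht θ hθ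
  exact eq_of_tendsto_nhdsGT_of_ae_eq hT hlim hae

/-- Global form: the datum of a global Leray–Hopf solution is weakly divergence free. [folklore] -/
theorem IsGlobalLerayHopf.isWeaklyDivFree_datum (hu : IsGlobalLerayHopf ν f u₀ u) :
    FunctionSpaces.Torus.IsWeaklyDivFree u₀ :=
  (hu 1 one_pos).isWeaklyDivFree_datum one_pos

end Datum

end Literature.Analysis.FluidPDE.Torus

end
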